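import Literature.Analysis.FluidPDE.LocalHelmholtzForce
import Literature.Analysis.FluidPDE.CKNLocalRegularityRRSGlueLR
import Literature.Analysis.FluidPDE.CKNEpsilonRegularityViscosity
import Literature.Analysis.FluidPDE.CKNLocalRegularityRRSStep3
import Literature.Analysis.FluidPDE.CKNLocalRegularityRRSStep2
import Literature.Analysis.FluidPDE.CKNLocalRegularityRRSCutoff
import Literature.Analysis.FluidPDE.CKNEpsilonRegularityDivFree
import HarnessLib

/-!
# Lemarié-Rieusset's Thm. 14.4 at unit scale and unit viscosity: removing `div f = 0`

Analysis/FluidPDE proof file (no definitions, no named facts) in the decomposition of the named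
fact `Literature.Analysis.FluidPDE.lemarieRieusset_epsilon_regularity_nu_one`
(`CKNEpsilonRegularityViscosity`: Lemarié-Rieusset 2016, Thm. 14.4 for `ν = 1`, `r₀ = 1`, about an
arbitrary centre). The accepted `lemarieRieusset_unitScale_nu_one_divFree_of_theorem15_3_force`
(`CKNLocalRegularityRRSGlueLR`) proves this statement from the first local regularity theorem
with force (`RRS2016.theorem15_3_force`) under the extra hypothesis `div f = 0` in `𝒟'(Ω)`,
which Step 3 of the Caffarelli–Kohn–Nirenberg / Robinson–Rodrigo–Sadowski induction needs for
the pressure equation. Lemarié-Rieusset's theorem has a general force `f ∈ L^q_t L^q_x(Ω)`; here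
the gap is closed by the classical device of Caffarelli–Kohn–Nirenberg 1982, §1 ("if `f` is not
divergence free, its gradient part may be absorbed into the pressure"), in the quantitative local
form supplied by `LocalHelmholtzForce`:

* `isLRSuitableWeakSolutionOn_absorb` — for `(Ω, f, u, p, G)` in the class of §14.3 with
  `ν = 1`, a unit cylinder `Q_1(z₀) ⊆ Ω` and `u ∈ L³(Q_1(z₀))`, let `(π, 𝒢)` be the localised
  Helmholtz pair of `g = 1_{Q_1(z₀)} f` (`𝒢 = ∇ₓπ` weakly, `g - 𝒢` solenoidal on `Q_1(z₀)`,
  `π ∈ L^{3/2}`, `𝒢 ∈ L^q`). Then `(Q_1(z₀), f - 𝒢, u, p - π, G)` is again in the class of §14.3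
  (the momentum equation is unchanged because `∫∫ (π div ψ + ⟪𝒢, ψ⟫) = 0`; the local energy
  inequality because `∫∫ (π u·∇φ + ⟪𝒢, u⟫ φ) = 0`, which is `div u = 0` tested with the smooth
  approximants `πₖ φ` and passed to the limit with `u ∈ L³`), with `div (f - 𝒢) = 0` in
  `𝒟'(Q_1(z₀))` (`divFree_absorb`), and the smallness hypotheses of Thm. 14.4 transfer with
  `λ ↦ K λ` for a constant `K = K(q)`.
* `lemarieRieusset_epsilon_regularity_nu_one_of_divFree` — the `ν = 1`, `r₀ = 1` statement for a
  general force follows from the same statement for solenoidal forces (also in the form of the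
  named statement `lemarieRieusset_epsilon_regularity_nu_one_divFree` of
  `CKNEpsilonRegularityDivFree`: `…_of_nu_one_divFree`);
* `lemarieRieusset_epsilon_regularity_nu_one_of_theorem15_3_force` — hence from
  `RRS2016.theorem15_3_force`; and `lemarieRieusset_epsilon_regularity_of_theorem15_3_force` —
  Thm. 14.4 itself (all `ν > 0`, all `r₀ > 0`), by the accepted
  `lemarieRieusset_epsilon_regularity_of_nu_one`.

What remains for `lemarieRieusset_epsilon_regularity_nu_one_holds`: the named fact
`RRS2016.lemma15_12` only (`lemarieRieusset_epsilon_regularity_nu_one_of_lemma15_12`: Step 2 with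
force is the accepted `RRS2016.step2_force_of_lemma15_11` with `RRS2016.lemma15_11_holds`, and the
induction is `theorem15_3_force_of_step2`, `CKNLocalRegularityRRSStep3`).

## References

* P. G. Lemarié-Rieusset, *The Navier–Stokes Problem in the 21st Century*, CRC Press (2016),
  Thm. 14.4, p. 505. [LemarieRieusset2016]
* L. Caffarelli, R. Kohn, L. Nirenberg, *Partial regularity of suitable weak solutions of the
  Navier–Stokes equations*, Comm. Pure Appl. Math. 35 (1982), 771–831, §1. [CaffarelliKohnNirenberg1982]
* J. C. Robinson, J. L. Rodrigo, W. Sadowski, *The three-dimensional Navier–Stokes equations*,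
  CUP (2016), Thm. 15.3. [RobinsonRodrigoSadowski2016]
-/

noncomputable section

open MeasureTheory Set Function Filter Topology TopologicalSpace Metric InnerProductSpace
open scoped NNReal ENNReal RealInnerProductSpace Laplacian ContDiff

namespace Literature.Analysis.FluidPDE

/-- Local notation for physical space `ℝ³ = EuclideanSpace ℝ (Fin 3)`. -/
local notation "ℝ³" => EuclideanSpace ℝ (Fin 3)

/-- The exponent `3/2`, in the coerced form of `LocalHelmholtzSlice`. -/
local notation "p₃₂" => ((3 / 2 : ℝ≥0) : ℝ≥0∞)

namespace AbsorbForce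

/-! ### Exponents and Hölder triples -/

/-- `((3/2 : ℝ≥0) : ℝ≥0∞) = ENNReal.ofReal (3/2)`. [folklore] -/
theorem p32_eq_ofReal : p₃₂ = ENNReal.ofReal (3 / 2 : ℝ) := by
  rw [show (3 / 2 : ℝ) = ((3 / 2 : ℝ≥0) : ℝ) by push_cast; ring, ENNReal.ofReal_coe_nnreal]

/-- `(3/2).toReal = 3/2`. [folklore] -/
theorem toReal_p32 : (p₃₂).toReal = 3 / 2 := by
  rw [ENNReal.coe_toReal]; push_cast; ring

/-- `1 ≤ 3/2`. [folklore] -/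
theorem one_le_p32 : (1 : ℝ≥0∞) ≤ p₃₂ := LocalHelmholtz.one_lt_p32.le

/-- The Hölder triple `(3/2, 3, 1)`. [folklore] -/
theorem holderTriple_p32_three : ENNReal.HolderTriple p₃₂ 3 1 := by
  refine ⟨?_⟩
  rw [inv_one, show (3 : ℝ≥0∞) = ((3 : ℝ≥0) : ℝ≥0∞) by norm_cast,
    ← ENNReal.coe_inv (by norm_num), ← ENNReal.coe_inv (by norm_num), ← ENNReal.coe_add,
    ← ENNReal.coe_one, ENNReal.coe_inj, ← NNReal.coe_inj]
  push_cast
  norm_num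

/-- The conjugate Hölder triple `(q, q/(q-1), 1)` for real `q > 1`. [folklore] -/
theorem holderTriple_conj {q : ℝ} (hq : 1 < q) :
    ENNReal.HolderTriple (ENNReal.ofReal q) (ENNReal.ofReal (q / (q - 1))) 1 := by
  refine ⟨?_⟩
  have hq0 : 0 < q := by linarith
  have hq1 : 0 < q - 1 := by linarith
  rw [inv_one, ← ENNReal.ofReal_inv_of_pos hq0, ← ENNReal.ofReal_inv_of_pos (by positivity),
    ← ENNReal.ofReal_add (by positivity) (by positivity), ← ENNReal.ofReal_one]
  congr 1
  rw [inv_div]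
  field_simp
  ring

/-- `q/(q-1) ≤ 3` for `q ≥ 3/2`. [folklore] -/
theorem conj_le_three {q : ℝ} (hq : 3 / 2 ≤ q) : q / (q - 1) ≤ 3 := by
  rw [div_le_iff₀ (by linarith)]; linarith

/-- `3/2 ≤ q` in `ℝ≥0∞`. [folklore] -/
theorem p32_le_ofReal {q : ℝ} (hq : 3 / 2 ≤ q) : p₃₂ ≤ ENNReal.ofReal q := by
  rw [p32_eq_ofReal]; exact ENNReal.ofReal_le_ofReal hq

/-! ### `L^r` bookkeeping -/

section Lr

variable {X : Type*} [MeasurableSpace X] {μ : Measure X} {F' : Type*} [NormedAddCommGroup F']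

/-- `∫ |f|^r ≤ a^r` gives `‖f‖_{L^r} ≤ a` (`r > 0`, `a ≥ 0`). [folklore] -/
theorem eLpNorm_le_of_lintegral_le {f : X → F'} {r a : ℝ} (hr : 0 < r) (ha : 0 ≤ a)
    (h : ∫⁻ x, ‖f x‖ₑ ^ r ∂μ ≤ ENNReal.ofReal (a ^ r)) :
    eLpNorm f (ENNReal.ofReal r) μ ≤ ENNReal.ofReal a := by
  have hr0 : ENNReal.ofReal r ≠ 0 := (ENNReal.ofReal_pos.2 hr).ne'
  rw [eLpNorm_eq_lintegral_rpow_enorm_toReal hr0 ENNReal.ofReal_ne_top, ENNReal.toReal_ofReal hr.le]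
  calc (∫⁻ x, ‖f x‖ₑ ^ r ∂μ) ^ (1 / r) ≤ (ENNReal.ofReal (a ^ r)) ^ (1 / r) :=
        ENNReal.rpow_le_rpow h (by positivity)
    _ = ENNReal.ofReal a := by
        rw [ENNReal.ofReal_rpow_of_nonneg (by positivity) (by positivity), one_div,
          Real.rpow_rpow_inv ha hr.ne']

/-- `‖f‖_{L^r} ≤ a` gives `∫ |f|^r ≤ a^r` (`r > 0`). [folklore] -/
theorem lintegral_le_of_eLpNorm_le {f : X → F'} {r : ℝ} (hr : 0 < r) {a : ℝ≥0∞}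
    (h : eLpNorm f (ENNReal.ofReal r) μ ≤ a) : ∫⁻ x, ‖f x‖ₑ ^ r ∂μ ≤ a ^ r := by
  have hr0 : ENNReal.ofReal r ≠ 0 := (ENNReal.ofReal_pos.2 hr).ne'
  rw [eLpNorm_eq_lintegral_rpow_enorm_toReal hr0 ENNReal.ofReal_ne_top,
    ENNReal.toReal_ofReal hr.le] at h
  have h2 := ENNReal.rpow_le_rpow h hr.le
  rwa [← ENNReal.rpow_mul, one_div_mul_cancel hr.ne', ENNReal.rpow_one] at h2

/-- Membership in `L^r` from a finite `∫ |f|^r` (`r > 0`). [folklore] -/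
theorem memLp_of_lintegral_lt_top {f : X → F'} {r : ℝ} (hr : 0 < r)
    (hf : AEStronglyMeasurable f μ) (h : ∫⁻ x, ‖f x‖ₑ ^ r ∂μ < ⊤) :
    MemLp f (ENNReal.ofReal r) μ := by
  have hr0 : ENNReal.ofReal r ≠ 0 := (ENNReal.ofReal_pos.2 hr).ne'
  refine ⟨hf, ?_⟩
  rw [eLpNorm_eq_lintegral_rpow_enorm_toReal hr0 ENNReal.ofReal_ne_top, ENNReal.toReal_ofReal hr.le]
  exact ENNReal.rpow_lt_top_of_nonneg (by positivity) h.ne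

/-- A product of an `L^a` and an `L^b` function with `1/a + 1/b = 1` is integrable (Hölder).
[folklore] -/
theorem integrable_mul_of_memLp {a b : ℝ≥0∞} (hab : ENNReal.HolderTriple a b 1) {φ ψ : X → ℝ}
    (hφ : MemLp φ a μ) (hψ : MemLp ψ b μ) : Integrable (fun x => φ x * ψ x) μ := by
  haveI := hab
  have := integrable_bilin_of_memLp (ContinuousLinearMap.mul ℝ ℝ) hφ hψ
  simpa only [ContinuousLinearMap.mul_apply'] using this

end Lr

/-! ### Extension by zero of pointwise bounds on a compact set -/

/-- If `g` vanishes off a compact set `K`, is a.e.-strongly measurable on `K`, and is bounded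
there by `C |B|` with `B` integrable on `K`, then `g` is integrable. [folklore] -/
theorem integrable_of_vanish {F' : Type*} [NormedAddCommGroup F'] {B : ℝ × ℝ³ → ℝ}
    {K : Set (ℝ × ℝ³)} (hK : IsCompact K) (hB : IntegrableOn B K volume) {g : ℝ × ℝ³ → F'}
    (hg : AEStronglyMeasurable g (volume.restrict K)) (hgK : ∀ z, z ∉ K → g z = 0) {C : ℝ}
    (hle : ∀ z ∈ K, ‖g z‖ ≤ C * ‖B z‖) : Integrable g volume := by
  have hsupp : support g ⊆ K := fun z hz => by by_contra h; exact hz (hgK z h)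
  refine (integrableOn_iff_integrable_of_support_subset hsupp).1 ?_
  exact Integrable.mono' (hB.norm.const_mul C) hg
    ((ae_restrict_iff' hK.measurableSet).2 (Eventually.of_forall hle))

/-! ### Two closure properties of space–time test functions -/

/-- A test function on `Q` times a jointly smooth function is a test function on `Q` (cf.
`IsSpaceTimeTestOn.mul_smooth`, not imported here). [folklore] -/
theorem isSpaceTimeTestOn_mul_smooth {Q : Opens (ℝ × ℝ³)} {φ H : ℝ → ℝ³ → ℝ}
    (hφ : IsSpaceTimeTestOn Q φ) (hH : ContDiff ℝ ∞ (uncurry H)) :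
    IsSpaceTimeTestOn Q (fun t x => φ t x * H t x) := by
  have e : uncurry (fun t x => φ t x * H t x) = fun z : ℝ × ℝ³ => uncurry φ z * uncurry H z := rfl
  refine ⟨?_, ?_, ?_⟩
  · rw [e]; exact hφ.contDiff.mul hH
  · rw [e]; exact hφ.hasCompactSupport.mul_right
  · rw [e]; exact (tsupport_mul_subset_left).trans hφ.tsupport_subset

/-- The spatial gradient of a product of smooth slices:
`⟪v, ∇(φH)(x)⟫ = φ(x) ⟪v, ∇H(x)⟫ + H(x) ⟪v, ∇φ(x)⟫`. [folklore] -/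
theorem inner_gradient_mul {φ H : ℝ³ → ℝ} {x : ℝ³} (hφ : DifferentiableAt ℝ φ x)
    (hH : DifferentiableAt ℝ H x) (v : ℝ³) :
    ⟪v, gradient (fun y => φ y * H y) x⟫ = φ x * ⟪v, gradient H x⟫ + H x * ⟪v, gradient φ x⟫ := by
  have e : ∀ g : ℝ³ → ℝ, ⟪v, gradient g x⟫ = fderiv ℝ g x v := fun g => by
    rw [real_inner_comm, LocalHelmholtz.inner_gradient_left_eq_fderiv]
  rw [e, e, e, fderiv_fun_mul hφ hH]
  rfl

end AbsorbForce

open AbsorbForce LocalHelmholtz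

/-! ### The setting: a suitable weak solution, a unit cylinder, and the Helmholtz pair -/

section Setting

variable {Ω : Opens (ℝ × ℝ³)} {q : ℝ} {f u : ℝ → ℝ³ → ℝ³} {p : ℝ → ℝ³ → ℝ}
  {G : ℝ → ℝ³ → ℝ³ →L[ℝ] ℝ³} {z₀ : ℝ × ℝ³}

/-- `1_{Q₁} f ∈ L^r(ℝ × ℝ³)` when `f ∈ L^r(Q₁)`. [folklore] -/
theorem memLp_indicator_cyl {r : ℝ≥0∞}
    (hf : MemLp (uncurry f) r (volume.restrict (parabolicCylinder 1 z₀))) :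
    MemLp ((parabolicCylinder 1 z₀).indicator (uncurry f)) r volume :=
  (memLp_indicator_iff_restrict (isOpen_parabolicCylinder 1 z₀).measurableSet).2 hf

/-- `‖1_{Q₁} f‖_{L^r(ℝ × ℝ³)} = ‖f‖_{L^r(Q₁)}`. [folklore] -/
theorem eLpNorm_indicator_cyl (z₀ : ℝ × ℝ³) (f : ℝ → ℝ³ → ℝ³) (r : ℝ≥0∞) :
    eLpNorm ((parabolicCylinder 1 z₀).indicator (uncurry f)) r volume =
      eLpNorm (uncurry f) r (volume.restrict (parabolicCylinder 1 z₀)) :=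
  eLpNorm_indicator_eq_eLpNorm_restrict (isOpen_parabolicCylinder 1 z₀).measurableSet

/-- The unit parabolic cylinder is connected. [folklore] -/
theorem isConnected_parabolicCylinder_one (z₀ : ℝ × ℝ³) : IsConnected (parabolicCylinder 1 z₀) := by
  refine ⟨⟨(z₀.1 - 1 / 2, z₀.2), ?_⟩, ?_⟩
  · rw [mem_parabolicCylinder, dist_self]
    exact ⟨⟨by norm_num, by norm_num⟩, by norm_num⟩
  · rw [parabolicCylinder]
    exact ((convex_Ioo _ _).prod (convex_ball _ _)).isPreconnected

/-- The volume of the unit parabolic cylinder does not depend on its centre: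
`|Q_1(z₀)| = |B(0, 1)|`. [folklore] -/
theorem volume_parabolicCylinder_one (z₀ : ℝ × ℝ³) :
    volume (parabolicCylinder 1 z₀) = volume (ball (0 : ℝ³) 1) := by
  rw [parabolicCylinder, Measure.volume_eq_prod, Measure.prod_prod, Real.volume_Ioo,
    Measure.addHaar_ball_center]
  norm_num

/-- The finite measure on the unit cylinder. [folklore] -/
theorem isFiniteMeasure_restrict_parabolicCylinder_one (z₀ : ℝ × ℝ³) :
    IsFiniteMeasure (volume.restrict (parabolicCylinder 1 z₀)) :=
  ⟨by rw [Measure.restrict_apply_univ]; exact (volume_parabolicCylinder_one_ne_top z₀).lt_top⟩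

end Setting

/-! ### The absorbed datum on the unit cylinder -/

section Main

variable {Ω : Opens (ℝ × ℝ³)} {q : ℝ} {f u : ℝ → ℝ³ → ℝ³} {p : ℝ → ℝ³ → ℝ}
  {G : ℝ → ℝ³ → ℝ³ →L[ℝ] ℝ³} {z₀ : ℝ × ℝ³} {π : ℝ × ℝ³ → ℝ} {𝒢 : ℝ × ℝ³ → ℝ³}
  {πs : ℕ → ℝ → ℝ³ → ℝ}

variable (hS : IsLRSuitableWeakSolutionOn Ω 1 q f u p G) (hq : 3 / 2 ≤ q)
  (hsub : parabolicCylinder 1 z₀ ⊆ (Ω : Set (ℝ × ℝ³)))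
  (hu3 : ∫⁻ w in parabolicCylinder 1 z₀, ‖u w.1 w.2‖ₑ ^ (3 : ℕ) < ⊤)
  (hπ : MemLp π p₃₂ volume) (h𝒢 : MemLp 𝒢 (ENNReal.ofReal q) volume)
  (hgrad : ∀ ψ : ℝ → ℝ³ → ℝ³, IsSpaceTimeTestOn (⊤ : Opens (ℝ × ℝ³)) ψ →
    ∫ z, π z * VectorCalculus.divergence (ψ z.1) z.2 = -∫ z, ⟪𝒢 z, ψ z.1 z.2⟫)
  (hdiv : ∀ θ : ℝ → ℝ³ → ℝ, IsSpaceTimeTestOn (parabolicCylinderOpens 1 z₀) θ →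
    ∫ z, ⟪(parabolicCylinder 1 z₀).indicator (uncurry f) z - 𝒢 z, gradient (θ z.1) z.2⟫ = 0)
  (hπs : ∀ k, IsSpaceTimeTestOn (⊤ : Opens (ℝ × ℝ³)) (πs k))
  (htπ : Tendsto (fun k => eLpNorm (uncurry (πs k) - π) p₃₂ volume) atTop (𝓝 0))
  (ht𝒢 : Tendsto (fun k => eLpNorm ((uncurry fun t x => gradient (πs k t) x) - 𝒢)
    (ENNReal.ofReal q) volume) atTop (𝓝 0))

/-! #### The classes on the cylinder -/

include hS hsub in
/-- The distributional solution on the unit cylinder. [folklore] -/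
theorem hns : IsDistributionalNSSolutionOn (parabolicCylinderOpens 1 z₀) 1 f u p :=
  hS.distributional.of_le (Q' := parabolicCylinderOpens 1 z₀) hsub

include hS hsub in
/-- `u` is a.e.-strongly measurable on `Q₁`. [folklore] -/
theorem aesm_u : AEStronglyMeasurable (uncurry u) (volume.restrict (parabolicCylinder 1 z₀)) :=
  (hns hS hsub).1.aestronglyMeasurable

include hS hsub hu3 in
/-- `u ∈ L³(Q₁)` as a `MemLp` statement. [folklore] -/
theorem memLp_u_three : MemLp (uncurry u) 3 (volume.restrict (parabolicCylinder 1 z₀)) := by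
  have h3 : MemLp (uncurry u) (ENNReal.ofReal 3) (volume.restrict (parabolicCylinder 1 z₀)) := by
    refine memLp_of_lintegral_lt_top (by norm_num) (aesm_u hS hsub) ?_
    have : (fun w : ℝ × ℝ³ => ‖uncurry u w‖ₑ ^ (3 : ℝ)) = fun w => ‖u w.1 w.2‖ₑ ^ (3 : ℕ) := by
      funext w; rw [← ENNReal.rpow_natCast]; rfl
    rw [this]; exact hu3
  rwa [show ENNReal.ofReal 3 = (3 : ℝ≥0∞) by norm_num] at h3

include hS hsub hu3 in
/-- `1_{Q₁} u ∈ L³(ℝ × ℝ³)`. [folklore] -/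
theorem memLp_uind_three :
    MemLp ((parabolicCylinder 1 z₀).indicator (uncurry u)) 3 volume :=
  (memLp_indicator_iff_restrict (isOpen_parabolicCylinder 1 z₀).measurableSet).2
    (memLp_u_three hS hsub hu3)

include hS hsub hu3 hq in
/-- `1_{Q₁} u ∈ L^{q'}(ℝ × ℝ³)` for the conjugate exponent `q' = q/(q-1) ≤ 3`. [folklore] -/
theorem memLp_uind_conj :
    MemLp ((parabolicCylinder 1 z₀).indicator (uncurry u)) (ENNReal.ofReal (q / (q - 1))) volume := by
  refine (memLp_uind_three hS hsub hu3).mono_exponent_of_measure_support_ne_top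
    (s := parabolicCylinder 1 z₀) (fun z hz => indicator_of_notMem hz _)
    (volume_parabolicCylinder_one_ne_top z₀) ?_
  calc ENNReal.ofReal (q / (q - 1)) ≤ ENNReal.ofReal 3 := ENNReal.ofReal_le_ofReal (conj_le_three hq)
    _ = 3 := by norm_num

include hS hsub in
/-- `p ∈ L^{3/2}(Q₁)` as a `MemLp` statement. [folklore] -/
theorem memLp_p_p32 : MemLp (uncurry p) p₃₂ (volume.restrict (parabolicCylinder 1 z₀)) := by
  have hm : AEStronglyMeasurable (uncurry p) (volume.restrict (parabolicCylinder 1 z₀)) :=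
    ((hns hS hsub).2.2.1).aestronglyMeasurable
  rw [p32_eq_ofReal]
  refine memLp_of_lintegral_lt_top (by norm_num) hm ?_
  exact (lintegral_mono_set hsub).trans_lt hS.pressure_lt_top

include hS hsub in
/-- `f ∈ L^q(Q₁)`. [folklore] -/
theorem memLp_f : MemLp (uncurry f) (ENNReal.ofReal q) (volume.restrict (parabolicCylinder 1 z₀)) :=
  hS.force_memLp.mono_measure (Measure.restrict_mono hsub le_rfl)

include hS hsub hq in
/-- `f` is integrable on `Q₁`. [folklore] -/
theorem integrableOn_f : IntegrableOn (uncurry f) (parabolicCylinder 1 z₀) volume := by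
  haveI := isFiniteMeasure_restrict_parabolicCylinder_one z₀
  have h1 : (1 : ℝ≥0∞) ≤ ENNReal.ofReal q := by
    rw [← ENNReal.ofReal_one]; exact ENNReal.ofReal_le_ofReal (by linarith)
  exact memLp_one_iff_integrable.1 ((memLp_f hS hsub).mono_exponent h1)

include hπ in
/-- `π` is integrable on `Q₁`. [folklore] -/
theorem integrableOn_π : IntegrableOn π (parabolicCylinder 1 z₀) volume := by
  haveI := isFiniteMeasure_restrict_parabolicCylinder_one z₀
  exact memLp_one_iff_integrable.1 ((hπ.restrict _).mono_exponent one_le_p32)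

include h𝒢 hq in
/-- `𝒢` is integrable on `Q₁`. [folklore] -/
theorem integrableOn_𝒢 : IntegrableOn 𝒢 (parabolicCylinder 1 z₀) volume := by
  haveI := isFiniteMeasure_restrict_parabolicCylinder_one z₀
  have h1 : (1 : ℝ≥0∞) ≤ ENNReal.ofReal q := by
    rw [← ENNReal.ofReal_one]; exact ENNReal.ofReal_le_ofReal (by linarith)
  exact memLp_one_iff_integrable.1 ((h𝒢.restrict _).mono_exponent h1)

/-! #### Integrability of the terms of the weak formulations -/

include hS hsub in
/-- `⟪u, w⟫` is integrable for a continuous weight `w` vanishing off a compact `K ⊆ Q₁`. [folklore] -/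
theorem integrable_inner_u {w : ℝ × ℝ³ → ℝ³} (hw : Continuous w) {K : Set (ℝ × ℝ³)}
    (hK : IsCompact K) (hKQ : K ⊆ parabolicCylinder 1 z₀) (hwK : ∀ z ∉ K, w z = 0) :
    Integrable (fun z : ℝ × ℝ³ => ⟪u z.1 z.2, w z⟫) volume :=
  integrable_inner_of_locallyIntegrableOn (hns hS hsub).1 hw hK hKQ hwK

include hS hsub in
/-- `‖u‖² w` is integrable for a continuous weight `w` vanishing off a compact `K ⊆ Q₁`. [folklore] -/
theorem integrable_sq_mul {w : ℝ × ℝ³ → ℝ} (hw : Continuous w) {K : Set (ℝ × ℝ³)}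
    (hK : IsCompact K) (hKQ : K ⊆ parabolicCylinder 1 z₀) (hwK : ∀ z ∉ K, w z = 0) :
    Integrable (fun z : ℝ × ℝ³ => ‖u z.1 z.2‖ ^ 2 * w z) volume :=
  integrable_mul_of_locallyIntegrableOn (hns hS hsub).2.1 hw hK hKQ hwK

include hS hsub in
/-- `p w` is integrable for a continuous weight `w` vanishing off a compact `K ⊆ Q₁`. [folklore] -/
theorem integrable_p_mul {w : ℝ × ℝ³ → ℝ} (hw : Continuous w) {K : Set (ℝ × ℝ³)}
    (hK : IsCompact K) (hKQ : K ⊆ parabolicCylinder 1 z₀) (hwK : ∀ z ∉ K, w z = 0) :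
    Integrable (fun z : ℝ × ℝ³ => p z.1 z.2 * w z) volume :=
  integrable_mul_of_locallyIntegrableOn (hns hS hsub).2.2.1 hw hK hKQ hwK

/-- A field integrable on `Q₁`, paired with a continuous weight vanishing off a compact
`K ⊆ Q₁`, is integrable. [folklore] -/
theorem integrable_inner_of_integrableOn {g : ℝ × ℝ³ → ℝ³}
    (hg : IntegrableOn g (parabolicCylinder 1 z₀) volume) {w : ℝ × ℝ³ → ℝ³} (hw : Continuous w)
    {K : Set (ℝ × ℝ³)} (hK : IsCompact K) (hKQ : K ⊆ parabolicCylinder 1 z₀)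
    (hwK : ∀ z ∉ K, w z = 0) : Integrable (fun z : ℝ × ℝ³ => ⟪g z, w z⟫) volume := by
  obtain ⟨C, hC⟩ := hw.bounded_above_of_compact_support (HasCompactSupport.intro hK hwK)
  have hgK : IntegrableOn g K volume := hg.mono_set hKQ
  refine integrable_of_vanish hK hgK.norm (hgK.aestronglyMeasurable.inner
    hw.aestronglyMeasurable.restrict) (fun z hz => by simp [hwK z hz]) (C := C) fun z _ => ?_
  calc ‖⟪g z, w z⟫‖ ≤ ‖g z‖ * ‖w z‖ := norm_inner_le_norm _ _
    _ ≤ ‖g z‖ * C := by gcongr; exact hC z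
    _ = C * ‖‖g z‖‖ := by rw [norm_norm]; ring

/-- A scalar integrable on `Q₁`, times a continuous weight vanishing off a compact `K ⊆ Q₁`, is
integrable. [folklore] -/
theorem integrable_mul_of_integrableOn {g : ℝ × ℝ³ → ℝ}
    (hg : IntegrableOn g (parabolicCylinder 1 z₀) volume) {w : ℝ × ℝ³ → ℝ} (hw : Continuous w)
    {K : Set (ℝ × ℝ³)} (hK : IsCompact K) (hKQ : K ⊆ parabolicCylinder 1 z₀)
    (hwK : ∀ z ∉ K, w z = 0) : Integrable (fun z : ℝ × ℝ³ => g z * w z) volume := by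
  obtain ⟨C, hC⟩ := hw.bounded_above_of_compact_support (HasCompactSupport.intro hK hwK)
  have hgK : IntegrableOn g K volume := hg.mono_set hKQ
  refine integrable_of_vanish hK hgK.norm (hgK.aestronglyMeasurable.mul
    hw.aestronglyMeasurable.restrict) (fun z hz => by simp [hwK z hz]) (C := C) fun z _ => ?_
  rw [norm_mul, norm_norm, mul_comm C]
  gcongr; exact hC z

include hS hsub in
/-- The convective pairing `⟪u, Dψ(u)⟫` is integrable for a test field `ψ` on `Q₁`. [folklore] -/
theorem integrable_convect {ψ : ℝ → ℝ³ → ℝ³}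
    (hψ : IsSpaceTimeTestOn (parabolicCylinderOpens 1 z₀) ψ) :
    Integrable (fun z : ℝ × ℝ³ => ⟪u z.1 z.2, convect (u z.1) (ψ z.1) z.2⟫) volume := by
  have hD : Continuous (fun z : ℝ × ℝ³ => fderiv ℝ (ψ z.1) z.2) :=
    (contDiff_uncurry_fderiv_slice hψ).continuous
  set K := tsupport (uncurry ψ)
  have hK : IsCompact K := hψ.hasCompactSupport
  have hKQ : K ⊆ parabolicCylinder 1 z₀ := hψ.tsupport_subset
  have hDK : ∀ z ∉ K, fderiv ℝ (ψ z.1) z.2 = 0 := fun z hz =>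
    fderiv_slice_eq_zero_of_notMem' (ψ := ψ) (t := z.1) (x := z.2) hz
  obtain ⟨C, hC⟩ := hD.bounded_above_of_compact_support (HasCompactSupport.intro hK hDK)
  have hB : IntegrableOn (fun z : ℝ × ℝ³ => ‖uncurry u z‖ ^ 2) K volume :=
    (hns hS hsub).2.1.integrableOn_compact_subset hKQ hK
  have huK : AEStronglyMeasurable (uncurry u) (volume.restrict K) :=
    (aesm_u hS hsub).mono_measure (Measure.restrict_mono hKQ le_rfl)
  have happ : Continuous (fun r : (ℝ³ →L[ℝ] ℝ³) × ℝ³ => r.1 r.2) :=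
    isBoundedBilinearMap_apply.continuous
  have hmeas : AEStronglyMeasurable (fun z : ℝ × ℝ³ => ⟪u z.1 z.2, convect (u z.1) (ψ z.1) z.2⟫)
      (volume.restrict K) :=
    huK.inner (happ.comp_aestronglyMeasurable (hD.aestronglyMeasurable.restrict.prodMk huK))
  refine integrable_of_vanish hK hB hmeas (fun z hz => by simp [convect, hDK z hz]) (C := C) ?_
  intro z _
  calc ‖⟪u z.1 z.2, convect (u z.1) (ψ z.1) z.2⟫‖
      ≤ ‖u z.1 z.2‖ * ‖convect (u z.1) (ψ z.1) z.2‖ := norm_inner_le_norm _ _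
    _ ≤ ‖u z.1 z.2‖ * (‖fderiv ℝ (ψ z.1) z.2‖ * ‖u z.1 z.2‖) := by
        gcongr; exact ContinuousLinearMap.le_opNorm _ _
    _ ≤ ‖u z.1 z.2‖ * (C * ‖u z.1 z.2‖) := by gcongr; exact hC z
    _ = C * ‖‖uncurry u z‖ ^ 2‖ := by
        rw [Real.norm_eq_abs, abs_of_nonneg (by positivity)]
        change _ = C * ‖u z.1 z.2‖ ^ 2
        ring

include hS hsub hu3 in
/-- The cubic pairing `‖u‖² ⟪u, w⟫` is integrable for a continuous weight `w` vanishing off a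
compact `K ⊆ Q₁` (here `u ∈ L³(Q₁)` is used). [folklore] -/
theorem integrable_cubic {w : ℝ × ℝ³ → ℝ³} (hw : Continuous w) {K : Set (ℝ × ℝ³)}
    (hK : IsCompact K) (hKQ : K ⊆ parabolicCylinder 1 z₀) (hwK : ∀ z ∉ K, w z = 0) :
    Integrable (fun z : ℝ × ℝ³ => ‖u z.1 z.2‖ ^ 2 * ⟪u z.1 z.2, w z⟫) volume := by
  obtain ⟨C, hC⟩ := hw.bounded_above_of_compact_support (HasCompactSupport.intro hK hwK)
  have h3 : Integrable (fun z => ‖uncurry u z‖ ^ 3) (volume.restrict (parabolicCylinder 1 z₀)) := by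
    have := memLp_u_three hS hsub hu3
    rw [show (3 : ℝ≥0∞) = ((3 : ℕ) : ℝ≥0∞) by norm_cast] at this
    exact this.integrable_norm_pow (by norm_num)
  have hB : IntegrableOn (fun z => ‖uncurry u z‖ ^ 3) K volume :=
    h3.mono_measure (Measure.restrict_mono hKQ le_rfl)
  have huK : AEStronglyMeasurable (uncurry u) (volume.restrict K) :=
    (aesm_u hS hsub).mono_measure (Measure.restrict_mono hKQ le_rfl)
  have hmeas : AEStronglyMeasurable (fun z : ℝ × ℝ³ => ‖u z.1 z.2‖ ^ 2 * ⟪u z.1 z.2, w z⟫)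
      (volume.restrict K) :=
    (huK.norm.pow 2).mul (huK.inner hw.aestronglyMeasurable.restrict)
  refine integrable_of_vanish hK hB hmeas (fun z hz => by simp [hwK z hz]) (C := C) fun z _ => ?_
  have h0 : 0 ≤ ‖u z.1 z.2‖ := norm_nonneg _
  calc ‖‖u z.1 z.2‖ ^ 2 * ⟪u z.1 z.2, w z⟫‖ = ‖u z.1 z.2‖ ^ 2 * ‖⟪u z.1 z.2, w z⟫‖ := by
        rw [norm_mul, Real.norm_eq_abs, abs_of_nonneg (by positivity)]
    _ ≤ ‖u z.1 z.2‖ ^ 2 * (‖u z.1 z.2‖ * ‖w z‖) := by gcongr; exact norm_inner_le_norm _ _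
    _ ≤ ‖u z.1 z.2‖ ^ 2 * (‖u z.1 z.2‖ * C) := by gcongr; exact hC z
    _ = C * ‖‖uncurry u z‖ ^ 3‖ := by
        rw [Real.norm_eq_abs, abs_of_nonneg (by positivity)]
        change _ = C * ‖u z.1 z.2‖ ^ 3
        ring

include hS hsub hu3 in
/-- The pressure pairing `p ⟪u, w⟫` is integrable (`p ∈ L^{3/2}`, `u ∈ L³` on `Q₁`, Hölder).
[folklore] -/
theorem integrable_p_u {w : ℝ × ℝ³ → ℝ³} (hw : Continuous w) {K : Set (ℝ × ℝ³)}
    (hK : IsCompact K) (hKQ : K ⊆ parabolicCylinder 1 z₀) (hwK : ∀ z ∉ K, w z = 0) :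
    Integrable (fun z : ℝ × ℝ³ => p z.1 z.2 * ⟪u z.1 z.2, w z⟫) volume := by
  obtain ⟨C, hC⟩ := hw.bounded_above_of_compact_support (HasCompactSupport.intro hK hwK)
  have hH : Integrable (fun z => uncurry p z * ‖uncurry u z‖)
      (volume.restrict (parabolicCylinder 1 z₀)) :=
    integrable_mul_of_memLp holderTriple_p32_three (memLp_p_p32 hS hsub)
      (memLp_u_three hS hsub hu3).norm
  have hB : IntegrableOn (fun z => uncurry p z * ‖uncurry u z‖) K volume :=
    hH.mono_measure (Measure.restrict_mono hKQ le_rfl)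
  have huK : AEStronglyMeasurable (uncurry u) (volume.restrict K) :=
    (aesm_u hS hsub).mono_measure (Measure.restrict_mono hKQ le_rfl)
  have hpK : AEStronglyMeasurable (uncurry p) (volume.restrict K) :=
    ((hns hS hsub).2.2.1.aestronglyMeasurable).mono_measure
      (Measure.restrict_mono hKQ le_rfl)
  have hmeas : AEStronglyMeasurable (fun z : ℝ × ℝ³ => p z.1 z.2 * ⟪u z.1 z.2, w z⟫)
      (volume.restrict K) := hpK.mul (huK.inner hw.aestronglyMeasurable.restrict)
  refine integrable_of_vanish hK hB hmeas (fun z hz => by simp [hwK z hz]) (C := C) fun z _ => ?_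
  calc ‖p z.1 z.2 * ⟪u z.1 z.2, w z⟫‖ = ‖p z.1 z.2‖ * ‖⟪u z.1 z.2, w z⟫‖ := norm_mul _ _
    _ ≤ ‖p z.1 z.2‖ * (‖u z.1 z.2‖ * ‖w z‖) := by gcongr; exact norm_inner_le_norm _ _
    _ ≤ ‖p z.1 z.2‖ * (‖u z.1 z.2‖ * C) := by gcongr; exact hC z
    _ = C * ‖uncurry p z * ‖uncurry u z‖‖ := by
        rw [norm_mul, norm_norm]; change _ = C * (‖p z.1 z.2‖ * ‖u z.1 z.2‖); ring

include hS hsub hu3 hπ in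
/-- The pairing `π ⟪u, w⟫` is integrable (`π ∈ L^{3/2}`, `u ∈ L³` on `Q₁`). [folklore] -/
theorem integrable_π_u {w : ℝ × ℝ³ → ℝ³} (hw : Continuous w) {K : Set (ℝ × ℝ³)}
    (hK : IsCompact K) (hKQ : K ⊆ parabolicCylinder 1 z₀) (hwK : ∀ z ∉ K, w z = 0) :
    Integrable (fun z : ℝ × ℝ³ => π z * ⟪u z.1 z.2, w z⟫) volume := by
  obtain ⟨C, hC⟩ := hw.bounded_above_of_compact_support (HasCompactSupport.intro hK hwK)
  have hH : Integrable (fun z => π z * ‖uncurry u z‖) (volume.restrict (parabolicCylinder 1 z₀)) :=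
    integrable_mul_of_memLp holderTriple_p32_three (hπ.restrict _) (memLp_u_three hS hsub hu3).norm
  have hB : IntegrableOn (fun z => π z * ‖uncurry u z‖) K volume :=
    hH.mono_measure (Measure.restrict_mono hKQ le_rfl)
  have huK : AEStronglyMeasurable (uncurry u) (volume.restrict K) :=
    (aesm_u hS hsub).mono_measure (Measure.restrict_mono hKQ le_rfl)
  have hmeas : AEStronglyMeasurable (fun z : ℝ × ℝ³ => π z * ⟪u z.1 z.2, w z⟫)
      (volume.restrict K) := hπ.1.restrict.mul (huK.inner hw.aestronglyMeasurable.restrict)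
  refine integrable_of_vanish hK hB hmeas (fun z hz => by simp [hwK z hz]) (C := C) fun z _ => ?_
  calc ‖π z * ⟪u z.1 z.2, w z⟫‖ = ‖π z‖ * ‖⟪u z.1 z.2, w z⟫‖ := norm_mul _ _
    _ ≤ ‖π z‖ * (‖u z.1 z.2‖ * ‖w z‖) := by gcongr; exact norm_inner_le_norm _ _
    _ ≤ ‖π z‖ * (‖u z.1 z.2‖ * C) := by gcongr; exact hC z
    _ = C * ‖π z * ‖uncurry u z‖‖ := by
        rw [norm_mul, norm_norm]; change _ = C * (‖π z‖ * ‖u z.1 z.2‖); ring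

include hS hsub hu3 hq in
/-- The force pairing `⟪g, u⟫ w` is integrable for `g ∈ L^q` on `Q₁` (`q ≥ 3/2`, `u ∈ L³`).
[folklore] -/
theorem integrable_force_u {g : ℝ × ℝ³ → ℝ³}
    (hg : MemLp g (ENNReal.ofReal q) (volume.restrict (parabolicCylinder 1 z₀)))
    {w : ℝ × ℝ³ → ℝ} (hw : Continuous w) {K : Set (ℝ × ℝ³)}
    (hK : IsCompact K) (hKQ : K ⊆ parabolicCylinder 1 z₀) (hwK : ∀ z ∉ K, w z = 0) :
    Integrable (fun z : ℝ × ℝ³ => ⟪g z, u z.1 z.2⟫ * w z) volume := by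
  obtain ⟨C, hC⟩ := hw.bounded_above_of_compact_support (HasCompactSupport.intro hK hwK)
  haveI := isFiniteMeasure_restrict_parabolicCylinder_one z₀
  have hu' : MemLp (fun z => ‖uncurry u z‖) (ENNReal.ofReal (q / (q - 1)))
      (volume.restrict (parabolicCylinder 1 z₀)) := by
    refine (memLp_u_three hS hsub hu3).norm.mono_exponent ?_
    calc ENNReal.ofReal (q / (q - 1)) ≤ ENNReal.ofReal 3 :=
          ENNReal.ofReal_le_ofReal (conj_le_three hq)
      _ = 3 := by norm_num
  have hH : Integrable (fun z => ‖g z‖ * ‖uncurry u z‖)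
      (volume.restrict (parabolicCylinder 1 z₀)) :=
    integrable_mul_of_memLp (holderTriple_conj (by linarith)) hg.norm hu'
  have hB : IntegrableOn (fun z => ‖g z‖ * ‖uncurry u z‖) K volume :=
    hH.mono_measure (Measure.restrict_mono hKQ le_rfl)
  have huK : AEStronglyMeasurable (uncurry u) (volume.restrict K) :=
    (aesm_u hS hsub).mono_measure (Measure.restrict_mono hKQ le_rfl)
  have hgK : AEStronglyMeasurable g (volume.restrict K) :=
    hg.1.mono_measure (Measure.restrict_mono hKQ le_rfl)
  have hmeas : AEStronglyMeasurable (fun z : ℝ × ℝ³ => ⟪g z, u z.1 z.2⟫ * w z)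
      (volume.restrict K) := (hgK.inner huK).mul hw.aestronglyMeasurable.restrict
  refine integrable_of_vanish hK hB hmeas (fun z hz => by simp [hwK z hz]) (C := C) fun z _ => ?_
  calc ‖⟪g z, u z.1 z.2⟫ * w z‖ = ‖⟪g z, u z.1 z.2⟫‖ * ‖w z‖ := norm_mul _ _
    _ ≤ (‖g z‖ * ‖u z.1 z.2‖) * C := by gcongr; exacts [norm_inner_le_norm _ _, hC z]
    _ = C * ‖‖g z‖ * ‖uncurry u z‖‖ := by
        rw [norm_mul, norm_norm, norm_norm]; change _ = C * (‖g z‖ * ‖u z.1 z.2‖); ring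

/-! #### The momentum equation is unchanged -/

include hπ h𝒢 hq hgrad in
/-- **`∫∫_{Q₁} (π div ψ + ⟪𝒢, ψ⟫) = 0`** for every test field `ψ` on `Q₁` (`𝒢 = ∇ₓπ` weakly).
[folklore] -/
theorem setIntegral_pi_div_add_inner_eq_zero {ψ : ℝ → ℝ³ → ℝ³}
    (hψ : IsSpaceTimeTestOn (parabolicCylinderOpens 1 z₀) ψ) :
    ∫ z in (parabolicCylinderOpens 1 z₀ : Set (ℝ × ℝ³)),
      (π z * VectorCalculus.divergence (ψ z.1) z.2 + ⟪𝒢 z, ψ z.1 z.2⟫) = 0 := by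
  set K := tsupport (uncurry ψ)
  have hK : IsCompact K := hψ.hasCompactSupport
  have hKQ : K ⊆ parabolicCylinder 1 z₀ := hψ.tsupport_subset
  have hdivc : Continuous (fun z : ℝ × ℝ³ => VectorCalculus.divergence (ψ z.1) z.2) :=
    (isSpaceTimeTestOn_divergence hψ).contDiff.continuous
  have hdiv0 : ∀ z ∉ K, VectorCalculus.divergence (ψ z.1) z.2 = 0 := fun z hz =>
    divergence_slice_eq_zero_of_notMem (ψ := ψ) (t := z.1) (x := z.2) hz
  have hψ0 : ∀ z ∉ K, ψ z.1 z.2 = 0 := fun z hz =>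
    (image_eq_zero_of_notMem_tsupport hz : uncurry ψ z = 0)
  have hI1 : Integrable (fun z : ℝ × ℝ³ => π z * VectorCalculus.divergence (ψ z.1) z.2) volume :=
    integrable_mul_of_integrableOn (integrableOn_π hπ) hdivc hK hKQ hdiv0
  have hI2 : Integrable (fun z : ℝ × ℝ³ => ⟪𝒢 z, ψ z.1 z.2⟫) volume :=
    integrable_inner_of_integrableOn (integrableOn_𝒢 hq h𝒢) hψ.contDiff.continuous hK hKQ hψ0
  rw [setIntegral_eq_integral_of_forall_compl_eq_zero fun z hz => ?_, integral_add hI1 hI2,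
    hgrad ψ (hψ.mono le_top), neg_add_cancel]
  have hzK : z ∉ K := fun h => hz (hKQ h)
  rw [hdiv0 z hzK, hψ0 z hzK, mul_zero, inner_zero_right, add_zero]

include hS hsub hq hπ h𝒢 hgrad in
/-- **The absorbed datum solves Navier–Stokes in `𝒟'(Q₁)`**: with the force `f - 𝒢` and the
pressure `p - π` the momentum equation is the old one minus `∫∫ (π div ψ + ⟪𝒢, ψ⟫) = 0`.
[folklore] -/
theorem isDistributionalNSSolutionOn_absorb :
    IsDistributionalNSSolutionOn (parabolicCylinderOpens 1 z₀) 1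
      (fun t x => f t x - 𝒢 (t, x)) u (fun t x => p t x - π (t, x)) := by
  obtain ⟨h1, h2, h3, h4, h5⟩ := hns hS hsub
  have hπloc : LocallyIntegrableOn (uncurry fun t x => π (t, x)) (parabolicCylinder 1 z₀) volume :=
    (hπ.locallyIntegrable one_le_p32).locallyIntegrableOn _
  refine ⟨h1, h2, h3.sub hπloc, h4, fun ψ hψ => ?_⟩
  -- integrability of the old terms on `Q₁`
  set K := tsupport (uncurry ψ)
  have hK : IsCompact K := hψ.hasCompactSupport
  have hKQ : K ⊆ parabolicCylinder 1 z₀ := hψ.tsupport_subset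
  have hψc := hψ.contDiff.continuous
  have hψ0 : ∀ z ∉ K, ψ z.1 z.2 = 0 := fun z hz =>
    (image_eq_zero_of_notMem_tsupport hz : uncurry ψ z = 0)
  have hTc : Continuous (fun z : ℝ × ℝ³ => timeDeriv ψ z.1 z.2) := hψ.continuous_timeDeriv
  have hT0 : ∀ z ∉ K, timeDeriv ψ z.1 z.2 = 0 := fun z hz =>
    IsSpaceTimeTestOn.timeDeriv_eq_zero_of_notMem hz
  have hLc : Continuous (fun z : ℝ × ℝ³ => Δ (ψ z.1) z.2) :=
    hψ.laplacian_isSpaceTimeTestOn.contDiff.continuous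
  have hL0 : ∀ z ∉ K, Δ (ψ z.1) z.2 = 0 := fun z hz => laplacian_slice_eq_zero_of_notMem_tsupport hz
  have hDc : Continuous (fun z : ℝ × ℝ³ => VectorCalculus.divergence (ψ z.1) z.2) :=
    (isSpaceTimeTestOn_divergence hψ).contDiff.continuous
  have hD0 : ∀ z ∉ K, VectorCalculus.divergence (ψ z.1) z.2 = 0 := fun z hz =>
    divergence_slice_eq_zero_of_notMem (ψ := ψ) (t := z.1) (x := z.2) hz
  have iA := integrable_inner_u hS hsub hTc hK hKQ hT0
  have iB := integrable_convect hS hsub hψ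
  have iC := integrable_inner_u hS hsub hLc hK hKQ hL0
  have iD := integrable_p_mul hS hsub hDc hK hKQ hD0
  have iE := integrable_inner_of_integrableOn (integrableOn_f hS hq hsub) hψc hK hKQ hψ0
  have iR : Integrable (fun z : ℝ × ℝ³ =>
      π z * VectorCalculus.divergence (ψ z.1) z.2 + ⟪𝒢 z, ψ z.1 z.2⟫) volume :=
    (integrable_mul_of_integrableOn (integrableOn_π hπ) hDc hK hKQ hD0).add
      (integrable_inner_of_integrableOn (integrableOn_𝒢 hq h𝒢) hψc hK hKQ hψ0)
  have iOld : Integrable (fun z : ℝ × ℝ³ =>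
      ⟪u z.1 z.2, timeDeriv ψ z.1 z.2⟫ + ⟪u z.1 z.2, convect (u z.1) (ψ z.1) z.2⟫ +
        1 * ⟪u z.1 z.2, Δ (ψ z.1) z.2⟫ + p z.1 z.2 * VectorCalculus.divergence (ψ z.1) z.2 +
        ⟪f z.1 z.2, ψ z.1 z.2⟫) volume :=
    (((iA.add iB).add (iC.const_mul 1)).add iD).add iE
  have hold := h5 ψ hψ
  have e : ∀ z : ℝ × ℝ³,
      ⟪u z.1 z.2, timeDeriv ψ z.1 z.2⟫ + ⟪u z.1 z.2, convect (u z.1) (ψ z.1) z.2⟫ +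
        1 * ⟪u z.1 z.2, Δ (ψ z.1) z.2⟫ +
        (p z.1 z.2 - π (z.1, z.2)) * VectorCalculus.divergence (ψ z.1) z.2 +
        ⟪f z.1 z.2 - 𝒢 (z.1, z.2), ψ z.1 z.2⟫ =
      (⟪u z.1 z.2, timeDeriv ψ z.1 z.2⟫ + ⟪u z.1 z.2, convect (u z.1) (ψ z.1) z.2⟫ +
        1 * ⟪u z.1 z.2, Δ (ψ z.1) z.2⟫ + p z.1 z.2 * VectorCalculus.divergence (ψ z.1) z.2 +
        ⟪f z.1 z.2, ψ z.1 z.2⟫) -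
      (π z * VectorCalculus.divergence (ψ z.1) z.2 + ⟪𝒢 z, ψ z.1 z.2⟫) := by
    intro z
    rw [inner_sub_left]
    simp only [Prod.mk.eta]
    ring
  simp_rw [e]
  rw [integral_sub iOld.integrableOn iR.integrableOn, hold,
    setIntegral_pi_div_add_inner_eq_zero hq hπ h𝒢 hgrad hψ, sub_zero]

/-! #### `div u = 0` against `π φ`: the local energy inequality is unchanged -/

include hS hsub hu3 hq hπ h𝒢 hπs htπ ht𝒢 in
/-- **`∫∫ (π ⟪u, ∇φ⟫ + ⟪𝒢, u⟫ φ) = 0`** for every test function `φ` on `Q₁`: this is `div u = 0`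
tested with the test functions `πₖ φ` (`∇(πₖφ) = πₖ∇φ + φ∇πₖ`), in the limit `k → ∞`
(`πₖ → π` in `L^{3/2}`, `∇πₖ → 𝒢` in `L^q`, against `u ∈ L³(Q₁)`). [folklore] -/
theorem integral_pi_u_gradient_add_eq_zero {φ : ℝ → ℝ³ → ℝ}
    (hφ : IsSpaceTimeTestOn (parabolicCylinderOpens 1 z₀) φ) :
    ∫ z, (π z * ⟪u z.1 z.2, gradient (φ z.1) z.2⟫ + ⟪𝒢 z, u z.1 z.2⟫ * φ z.1 z.2) = 0 := by
  set Q := parabolicCylinder 1 z₀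
  set U : ℝ × ℝ³ → ℝ³ := Q.indicator (uncurry u) with hU
  have hQm : MeasurableSet Q := (isOpen_parabolicCylinder 1 z₀).measurableSet
  have hU3 : MemLp U 3 volume := memLp_uind_three hS hsub hu3
  have hUq : MemLp U (ENNReal.ofReal (q / (q - 1))) volume := memLp_uind_conj hS hq hsub hu3
  -- the two fixed factors `B₁ = ⟪U, ∇φ⟫ ∈ L³`, `B₂ = φ U ∈ L^{q'}`
  obtain ⟨hgc, -, hg0⟩ := hφ.continuous_gradient_field
  obtain ⟨C₁, hC₁⟩ := hgc.bounded_above_of_compact_support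
    (HasCompactSupport.intro hφ.hasCompactSupport hg0)
  obtain ⟨C₂, hC₂⟩ := hφ.contDiff.continuous.bounded_above_of_compact_support hφ.hasCompactSupport
  set B₁ : ℝ × ℝ³ → ℝ := fun z => ⟪U z, gradient (φ z.1) z.2⟫ with hB₁def
  set B₂ : ℝ × ℝ³ → ℝ³ := fun z => φ z.1 z.2 • U z with hB₂def
  have hB₁ : MemLp B₁ 3 volume := by
    refine hU3.of_le_mul (hU3.1.inner hgc.aestronglyMeasurable) (c := C₁)
      (Eventually.of_forall fun z => ?_)
    calc ‖B₁ z‖ ≤ ‖U z‖ * ‖gradient (φ z.1) z.2‖ := norm_inner_le_norm _ _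
      _ ≤ ‖U z‖ * C₁ := by gcongr; exact hC₁ z
      _ = C₁ * ‖U z‖ := mul_comm _ _
  have hB₂ : MemLp B₂ (ENNReal.ofReal (q / (q - 1))) volume := by
    refine hUq.of_le_mul ((hφ.contDiff.continuous.aestronglyMeasurable).smul hUq.1) (c := C₂)
      (Eventually.of_forall fun z => ?_)
    rw [hB₂def, norm_smul]
    gcongr; exact hC₂ z
  -- the identity at level `k`
  have hk : ∀ k, (∫ z, uncurry (πs k) z * B₁ z) +
      ∫ z, ⟪(uncurry fun t x => gradient (πs k t) x) z, B₂ z⟫ = 0 := by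
    intro k
    have hθ : IsSpaceTimeTestOn (parabolicCylinderOpens 1 z₀) (fun t x => φ t x * πs k t x) :=
      isSpaceTimeTestOn_mul_smooth hφ (hπs k).contDiff
    have key : ∫ z in Q, ⟪u z.1 z.2, gradient (fun y => φ z.1 y * πs k z.1 y) z.2⟫ = 0 :=
      (hns hS hsub).2.2.2.1 _ hθ
    -- rewrite the integrand of `key`
    have e : ∀ z ∈ Q, ⟪u z.1 z.2, gradient (fun y => φ z.1 y * πs k z.1 y) z.2⟫ =
        uncurry (πs k) z * B₁ z + ⟪(uncurry fun t x => gradient (πs k t) x) z, B₂ z⟫ := by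
      intro z hz
      have hUz : U z = u z.1 z.2 := indicator_of_mem hz _
      rw [inner_gradient_mul ((hφ.contDiff_slice z.1).differentiable (by simp) z.2)
        (((hπs k).contDiff_slice z.1).differentiable (by simp) z.2)]
      simp only [hB₁def, hB₂def, hUz, uncurry, inner_smul_right, real_inner_comm (u z.1 z.2)]
      ring
    rw [setIntegral_congr_fun hQm e] at key
    -- pass from `Q₁` to the whole space–time and split
    have hi1 : Integrable (fun z => uncurry (πs k) z * B₁ z) volume := by
      haveI := holderTriple_p32_three
      exact integrable_mul_of_memLp holderTriple_p32_three
        ((hπs k).contDiff.continuous.memLp_of_hasCompactSupport (hπs k).hasCompactSupport) hB₁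
    have hi2 : Integrable (fun z => ⟪(uncurry fun t x => gradient (πs k t) x) z, B₂ z⟫) volume := by
      haveI := holderTriple_conj (q := q) (by linarith)
      have hG := isSpaceTimeTestOn_gradient (hπs k)
      exact integrable_bilin_of_memLp (p := ENNReal.ofReal q) (innerSL ℝ (E := ℝ³))
        (hG.contDiff.continuous.memLp_of_hasCompactSupport hG.hasCompactSupport) hB₂
    rw [setIntegral_eq_integral_of_forall_compl_eq_zero, integral_add hi1 hi2] at key
    · exact key
    · intro z hz
      have hUz : U z = 0 := indicator_of_notMem hz _
      simp [hB₁def, hB₂def, hUz]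
  -- the two limits
  have hL1 : Tendsto (fun k => ∫ z, uncurry (πs k) z * B₁ z) atTop (𝓝 (∫ z, π z * B₁ z)) := by
    haveI := holderTriple_p32_three
    have h := tendsto_setIntegral_mul_bilin (μ := volume) (p := p₃₂) (q := 3) (by norm_num)
      (ContinuousLinearMap.mul ℝ ℝ) (A := fun k => uncurry (πs k)) (A₀ := π) (B := fun _ => B₁)
      (B₀ := B₁)
      (fun k => (hπs k).contDiff.continuous.memLp_of_hasCompactSupport (hπs k).hasCompactSupport)
      hπ (fun _ => hB₁) hB₁ htπ (by simp)
      (w := fun _ => (1 : ℝ)) (C := 1) aestronglyMeasurable_const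
      (Eventually.of_forall fun _ => by simp) univ
    simpa only [ContinuousLinearMap.mul_apply', one_mul, Measure.restrict_univ] using h
  have hL2 : Tendsto (fun k => ∫ z, ⟪(uncurry fun t x => gradient (πs k t) x) z, B₂ z⟫) atTop
      (𝓝 (∫ z, ⟪𝒢 z, B₂ z⟫)) := by
    haveI := holderTriple_conj (q := q) (by linarith)
    have h1q : (1 : ℝ≥0∞) ≤ ENNReal.ofReal (q / (q - 1)) := by
      rw [← ENNReal.ofReal_one]
      refine ENNReal.ofReal_le_ofReal ?_
      rw [le_div_iff₀ (by linarith)]; linarith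
    have h := tendsto_setIntegral_mul_bilin (μ := volume) (p := ENNReal.ofReal q)
      (q := ENNReal.ofReal (q / (q - 1))) h1q (innerSL ℝ (E := ℝ³))
      (A := fun k => uncurry fun t x => gradient (πs k t) x) (A₀ := 𝒢) (B := fun _ => B₂) (B₀ := B₂)
      (fun k => (isSpaceTimeTestOn_gradient (hπs k)).contDiff.continuous.memLp_of_hasCompactSupport
        (isSpaceTimeTestOn_gradient (hπs k)).hasCompactSupport)
      h𝒢 (fun _ => hB₂) hB₂ ht𝒢 (by simp)
      (w := fun _ => (1 : ℝ)) (C := 1) aestronglyMeasurable_const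
      (Eventually.of_forall fun _ => by simp) univ
    have h' : Tendsto (fun k => ∫ z in univ, (1 : ℝ) * ⟪(uncurry fun t x => gradient (πs k t) x) z, B₂ z⟫)
        atTop (𝓝 (∫ z in univ, (1 : ℝ) * ⟪𝒢 z, B₂ z⟫)) := h
    simp only [Measure.restrict_univ, one_mul] at h'
    exact h'
  have hsum := hL1.add hL2
  simp only [hk] at hsum
  have h0 := tendsto_nhds_unique hsum tendsto_const_nhds
  -- back to the `u`-form
  have hi1 : Integrable (fun z => π z * B₁ z) volume := by
    exact integrable_mul_of_memLp holderTriple_p32_three hπ hB₁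
  have hi2 : Integrable (fun z => ⟪𝒢 z, B₂ z⟫) volume := by
    haveI := holderTriple_conj (q := q) (by linarith)
    exact integrable_bilin_of_memLp (innerSL ℝ (E := ℝ³)) h𝒢 hB₂
  rw [← integral_add hi1 hi2] at h0
  rw [← h0]
  refine integral_congr_ae (Eventually.of_forall fun z => ?_)
  by_cases hz : z ∈ Q
  · have hUz : U z = u z.1 z.2 := indicator_of_mem hz _
    simp only [hB₁def, hB₂def, hUz, inner_smul_right, real_inner_comm (u z.1 z.2)]
    ring
  · have hg : gradient (φ z.1) z.2 = 0 := hg0 z fun h => hz (hφ.tsupport_subset h)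
    have hφz : φ z.1 z.2 = 0 := hφ.apply_eq_zero (by exact hz)
    simp only [hB₁def, hB₂def, hg, hφz, inner_zero_right, mul_zero, zero_smul, add_zero]

include hS hsub hu3 hq hπ h𝒢 hπs htπ ht𝒢 in
/-- **The local energy inequality for the absorbed datum.** Its right-hand side differs from
the old one by `-2 ∫∫ (π ⟪u, ∇φ⟫ + ⟪𝒢, u⟫ φ) = 0`; all integrands are integrable on `ℝ × ℝ³`
(`u ∈ L³(Q₁)`), so the iterated integrals are integrals over `ℝ × ℝ³`. [folklore] -/
theorem localEnergy_absorb {φ : ℝ → ℝ³ → ℝ}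
    (hφ : IsSpaceTimeTestOn (parabolicCylinderOpens 1 z₀) φ) (hφ0 : ∀ t x, 0 ≤ φ t x) :
    2 * (1 : ℝ) * ∫ t, ∫ x, frobeniusNormSq (G t x) * φ t x ≤
      ∫ t, ∫ x, (‖u t x‖ ^ 2 * (timeDeriv φ t x + 1 * Δ (φ t) x) +
        (‖u t x‖ ^ 2 + 2 * (p t x - π (t, x))) * ⟪u t x, gradient (φ t) x⟫ +
        2 * ⟪f t x - 𝒢 (t, x), u t x⟫ * φ t x) := by
  have hold := hS.localEnergy φ (hφ.mono hsub) hφ0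
  -- weights and their supports
  set K := tsupport (uncurry φ)
  have hK : IsCompact K := hφ.hasCompactSupport
  have hKQ : K ⊆ parabolicCylinder 1 z₀ := hφ.tsupport_subset
  have hφc := hφ.contDiff.continuous
  have hφ0' : ∀ z ∉ K, φ z.1 z.2 = 0 := fun z hz =>
    (image_eq_zero_of_notMem_tsupport hz : uncurry φ z = 0)
  obtain ⟨hgc, -, hg0⟩ := hφ.continuous_gradient_field
  have hWc : Continuous (fun z : ℝ × ℝ³ => timeDeriv φ z.1 z.2 + 1 * Δ (φ z.1) z.2) :=
    hφ.continuous_timeDeriv.add (continuous_const.mul hφ.laplacian_isSpaceTimeTestOn.contDiff.continuous)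
  have hW0 : ∀ z ∉ K, timeDeriv φ z.1 z.2 + 1 * Δ (φ z.1) z.2 = 0 := fun z hz => by
    rw [IsSpaceTimeTestOn.timeDeriv_eq_zero_of_notMem hz, laplacian_slice_eq_zero_of_notMem_tsupport hz]
    ring
  -- integrability of the old terms and of the correction
  have i1 := integrable_sq_mul hS hsub hWc hK hKQ hW0
  have i2 := integrable_cubic hS hsub hu3 hgc hK hKQ hg0
  have i3 := integrable_p_u hS hsub hu3 hgc hK hKQ hg0
  have i4 := integrable_force_u hS hq hsub hu3 (memLp_f hS hsub) hφc hK hKQ hφ0'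
  have i5 := integrable_π_u hS hsub hu3 hπ hgc hK hKQ hg0
  have i6 := integrable_force_u hS hq hsub hu3 (h𝒢.restrict _) hφc hK hKQ hφ0'
  -- the old integrand, as a function on `ℝ × ℝ³`
  set A : ℝ × ℝ³ → ℝ := fun z => ‖u z.1 z.2‖ ^ 2 * (timeDeriv φ z.1 z.2 + 1 * Δ (φ z.1) z.2) +
    (‖u z.1 z.2‖ ^ 2 + 2 * p z.1 z.2) * ⟪u z.1 z.2, gradient (φ z.1) z.2⟫ +
    2 * ⟪f z.1 z.2, u z.1 z.2⟫ * φ z.1 z.2 with hA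
  set D : ℝ × ℝ³ → ℝ := fun z => 2 * (π z * ⟪u z.1 z.2, gradient (φ z.1) z.2⟫ +
    ⟪𝒢 z, u z.1 z.2⟫ * φ z.1 z.2) with hD
  have hAi : Integrable A volume := by
    have := (i1.add (i2.add (i3.const_mul 2))).add (i4.const_mul 2)
    refine this.congr (Eventually.of_forall fun z => ?_)
    simp only [hA, Pi.add_apply, uncurry]
    ring
  have hDi : Integrable D volume := by
    refine ((i5.add i6).const_mul 2).congr (Eventually.of_forall fun z => ?_)
    simp only [hD, Pi.add_apply, uncurry]
  have hAold : ∀ t x, ‖u t x‖ ^ 2 * (timeDeriv φ t x + 1 * Δ (φ t) x) +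
      (‖u t x‖ ^ 2 + 2 * p t x) * ⟪u t x, gradient (φ t) x⟫ + 2 * ⟪f t x, u t x⟫ * φ t x = A (t, x) := by
    intro t x
    simp only [hA]
  have hAD : ∀ t x, ‖u t x‖ ^ 2 * (timeDeriv φ t x + 1 * Δ (φ t) x) +
      (‖u t x‖ ^ 2 + 2 * (p t x - π (t, x))) * ⟪u t x, gradient (φ t) x⟫ +
      2 * ⟪f t x - 𝒢 (t, x), u t x⟫ * φ t x = A (t, x) - D (t, x) := by
    intro t x
    simp only [hA, hD, inner_sub_left]
    ring
  have hD0 : ∫ z, D z = 0 := by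
    rw [hD, integral_const_mul, integral_pi_u_gradient_add_eq_zero hS hq hsub hu3 hπ h𝒢 hπs htπ ht𝒢 hφ,
      mul_zero]
  calc 2 * (1 : ℝ) * ∫ t, ∫ x, frobeniusNormSq (G t x) * φ t x
      ≤ ∫ t, ∫ x, (‖u t x‖ ^ 2 * (timeDeriv φ t x + 1 * Δ (φ t) x) +
          (‖u t x‖ ^ 2 + 2 * p t x) * ⟪u t x, gradient (φ t) x⟫ + 2 * ⟪f t x, u t x⟫ * φ t x) := hold
    _ = ∫ t, ∫ x, A (t, x) :=
        integral_congr_ae (Eventually.of_forall fun t =>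
          integral_congr_ae (Eventually.of_forall fun x => hAold t x))
    _ = ∫ z, A z := by
        rw [Measure.volume_eq_prod]
        exact integral_integral (f := fun t x => A (t, x)) (by rwa [← Measure.volume_eq_prod])
    _ = ∫ z, (A z - D z) := by rw [integral_sub hAi hDi, hD0, sub_zero]
    _ = ∫ t, ∫ x, (A (t, x) - D (t, x)) := by
        rw [Measure.volume_eq_prod]
        exact (integral_integral (f := fun t x => A (t, x) - D (t, x))
          (by rw [← Measure.volume_eq_prod]; exact hAi.sub hDi)).symm
    _ = ∫ t, ∫ x, (‖u t x‖ ^ 2 * (timeDeriv φ t x + 1 * Δ (φ t) x) +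
          (‖u t x‖ ^ 2 + 2 * (p t x - π (t, x))) * ⟪u t x, gradient (φ t) x⟫ +
          2 * ⟪f t x - 𝒢 (t, x), u t x⟫ * φ t x) :=
        integral_congr_ae (Eventually.of_forall fun t =>
          integral_congr_ae (Eventually.of_forall fun x => (hAD t x).symm))

/-! #### The new datum is in the class of §14.3, with solenoidal force -/

include hS hsub hu3 hq hπ h𝒢 hgrad hπs htπ ht𝒢 in
/-- **The absorbed datum `(Q₁, f - 𝒢, u, p - π, G)` satisfies the §14.3 hypotheses with
`ν = 1`.** [cite: CaffarelliKohnNirenberg1982, §1 (gradient part of the force absorbed into the pressure)] -/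
theorem isLRSuitableWeakSolutionOn_absorb :
    IsLRSuitableWeakSolutionOn (parabolicCylinderOpens 1 z₀) 1 q (fun t x => f t x - 𝒢 (t, x)) u
      (fun t x => p t x - π (t, x)) G := by
  have hle : parabolicCylinderOpens 1 z₀ ≤ Ω := hsub
  haveI := isFiniteMeasure_restrict_parabolicCylinder_one z₀
  refine
    { isConnected := isConnected_parabolicCylinder_one z₀
      energyClass := ?_
      weakGradient := hS.weakGradient.mono hle
      gradient_lt_top := (lintegral_mono_set hsub).trans_lt hS.gradient_lt_top
      pressure_lt_top := ?_
      force_memLp := ?_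
      distributional := isDistributionalNSSolutionOn_absorb hS hq hsub hπ h𝒢 hgrad
      localEnergy := fun φ hφ hφ0 => localEnergy_absorb hS hq hsub hu3 hπ h𝒢 hπs htπ ht𝒢 hφ hφ0 }
  · obtain ⟨C, hC⟩ := hS.energyClass
    refine ⟨C, ?_⟩
    filter_upwards [hC] with t ht
    refine (lintegral_mono fun x => ?_).trans ht
    exact indicator_le_indicator_of_subset hsub (fun _ => zero_le) _
  · -- `p - π ∈ L^{3/2}(Q₁)`
    have hm : MemLp (uncurry fun t x => p t x - π (t, x)) p₃₂
        (volume.restrict (parabolicCylinder 1 z₀)) := (memLp_p_p32 hS hsub).sub (hπ.restrict _)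
    have := hm.eLpNorm_lt_top
    rw [p32_eq_ofReal, eLpNorm_lt_top_iff_lintegral_rpow_enorm_lt_top
      (ENNReal.ofReal_pos.2 (by norm_num)).ne' ENNReal.ofReal_ne_top,
      ENNReal.toReal_ofReal (by norm_num)] at this
    exact this
  · exact (memLp_f hS hsub).sub (h𝒢.restrict _)

include hS hsub hq h𝒢 hdiv in
/-- **`div (f - 𝒢) = 0` in `𝒟'(Q₁)`**, in the iterated form consumed by
`lemarieRieusset_unitScale_nu_one_divFree_of_theorem15_3_force`. [folklore] -/
theorem divFree_absorb {θ : ℝ → ℝ³ → ℝ} (hθ : IsSpaceTimeTestOn (parabolicCylinderOpens 1 z₀) θ) :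
    ∫ t, ∫ x, ⟪f t x - 𝒢 (t, x), gradient (θ t) x⟫ = 0 := by
  obtain ⟨hgc, -, hg0⟩ := hθ.continuous_gradient_field
  set K := tsupport (uncurry θ)
  have hK : IsCompact K := hθ.hasCompactSupport
  have hKQ : K ⊆ parabolicCylinder 1 z₀ := hθ.tsupport_subset
  have hI : Integrable (fun z : ℝ × ℝ³ => ⟪f z.1 z.2 - 𝒢 (z.1, z.2), gradient (θ z.1) z.2⟫) volume := by
    have h1 := integrable_inner_of_integrableOn (integrableOn_f hS hq hsub) hgc hK hKQ hg0
    have h2 := integrable_inner_of_integrableOn (integrableOn_𝒢 hq h𝒢) hgc hK hKQ hg0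
    refine (h1.sub h2).congr (Eventually.of_forall fun z => ?_)
    simp only [Pi.sub_apply, inner_sub_left, uncurry, Prod.mk.eta]
  rw [Measure.volume_eq_prod] at hI
  rw [integral_integral hI, ← Measure.volume_eq_prod, ← hdiv θ hθ]
  refine integral_congr_ae (Eventually.of_forall fun z => ?_)
  by_cases hz : z ∈ parabolicCylinder 1 z₀
  · beta_reduce
    rw [indicator_of_mem hz]
    rfl
  · have : gradient (θ z.1) z.2 = 0 := hg0 z fun h => hz (hKQ h)
    simp [this]

end Main

/-! ### The smallness hypotheses transfer -/

section Bounds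

variable {q : ℝ} {f u : ℝ → ℝ³ → ℝ³} {p : ℝ → ℝ³ → ℝ} {z₀ : ℝ × ℝ³} {π : ℝ × ℝ³ → ℝ}
  {𝒢 : ℝ × ℝ³ → ℝ³} {l : ℝ} {Cg Cπ : ℝ≥0}

/-- The Hölder factor `|Q₁|^{2/3 - 1/q}`, a constant depending on `q` only. [folklore] -/
theorem volumeFactor_ne_top (hq : 3 / 2 ≤ q) :
    volume (ball (0 : ℝ³) 1) ^ (1 / (p₃₂).toReal - 1 / (ENNReal.ofReal q).toReal) ≠ ⊤ := by
  refine ENNReal.rpow_ne_top_of_nonneg ?_ measure_ball_lt_top.ne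
  rw [toReal_p32, ENNReal.toReal_ofReal (by linarith), sub_nonneg,
    div_le_div_iff₀ (by linarith) (by norm_num)]
  linarith

/-- **The force bound transfers**: from `∫∫_{Q₁} |f|^q ≤ λ^{2q}` and `‖𝒢‖_{L^q} ≤ C_g ‖1_{Q₁}f‖_{L^q}`
to `∫∫_{Q₁} |f - 𝒢|^q ≤ (Kλ)^{2q}` for every `K ≥ 1 + C_g`. [folklore] -/
theorem lintegral_force_sub_le (hq : 3 / 2 ≤ q) (hl : 0 ≤ l)
    (hf : MemLp (uncurry f) (ENNReal.ofReal q) (volume.restrict (parabolicCylinder 1 z₀)))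
    (h𝒢 : MemLp 𝒢 (ENNReal.ofReal q) volume)
    (hG : eLpNorm 𝒢 (ENNReal.ofReal q) volume ≤
      Cg * eLpNorm ((parabolicCylinder 1 z₀).indicator (uncurry f)) (ENNReal.ofReal q) volume)
    (hF : ∫⁻ w in parabolicCylinder 1 z₀, ‖f w.1 w.2‖ₑ ^ q ≤ ENNReal.ofReal (l ^ (2 * q)))
    {K : ℝ} (hK : 1 + (Cg : ℝ) ≤ K) :
    ∫⁻ w in parabolicCylinder 1 z₀, ‖f w.1 w.2 - 𝒢 (w.1, w.2)‖ₑ ^ q ≤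
      ENNReal.ofReal ((K * l) ^ (2 * q)) := by
  have hq0 : 0 < q := by linarith
  have hK1 : 1 ≤ K := le_trans (by simp) hK
  set μ := volume.restrict (parabolicCylinder 1 z₀)
  -- `‖f‖_{L^q(Q₁)} ≤ λ²`
  have hf2 : eLpNorm (uncurry f) (ENNReal.ofReal q) μ ≤ ENNReal.ofReal (l ^ 2) := by
    refine eLpNorm_le_of_lintegral_le hq0 (by positivity) ?_
    have e : (l ^ 2) ^ q = l ^ (2 * q) := by
      rw [← Real.rpow_natCast l 2, ← Real.rpow_mul hl]; norm_num
    rw [e]; exact hF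
  -- `‖f - 𝒢‖_{L^q(Q₁)} ≤ (1 + C_g) λ²`
  have hsub' : eLpNorm (uncurry fun t x => f t x - 𝒢 (t, x)) (ENNReal.ofReal q) μ ≤
      ENNReal.ofReal ((1 + Cg) * l ^ 2) := by
    have h1q : (1 : ℝ≥0∞) ≤ ENNReal.ofReal q := by
      rw [← ENNReal.ofReal_one]; exact ENNReal.ofReal_le_ofReal (by linarith)
    have e : (uncurry fun t x => f t x - 𝒢 (t, x)) = uncurry f - 𝒢 := by
      funext z; rfl
    rw [e]
    calc eLpNorm (uncurry f - 𝒢) (ENNReal.ofReal q) μ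
        ≤ eLpNorm (uncurry f) (ENNReal.ofReal q) μ + eLpNorm 𝒢 (ENNReal.ofReal q) μ :=
          eLpNorm_sub_le hf.1 (h𝒢.restrict _).1 h1q
      _ ≤ ENNReal.ofReal (l ^ 2) + Cg * ENNReal.ofReal (l ^ 2) := by
          refine add_le_add hf2 ?_
          refine (eLpNorm_mono_measure 𝒢 Measure.restrict_le_self).trans (hG.trans ?_)
          rw [eLpNorm_indicator_cyl]
          exact mul_le_mul_right hf2 _
      _ = ENNReal.ofReal ((1 + Cg) * l ^ 2) := by
          rw [ENNReal.ofReal_mul (by positivity), ENNReal.ofReal_add zero_le_one (by positivity),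
            ENNReal.ofReal_one, ENNReal.ofReal_coe_nnreal]
          ring
  have h2 := lintegral_le_of_eLpNorm_le hq0 hsub'
  refine h2.trans ?_
  rw [ENNReal.ofReal_rpow_of_nonneg (by positivity) hq0.le]
  refine ENNReal.ofReal_le_ofReal ?_
  have e : (K * l) ^ (2 * q) = (K ^ 2 * l ^ 2) ^ q := by
    rw [show K ^ 2 * l ^ 2 = (K * l) ^ 2 by ring, ← Real.rpow_natCast (K * l) 2,
      ← Real.rpow_mul (by positivity)]; norm_num
  rw [e]
  refine Real.rpow_le_rpow (by positivity) ?_ hq0.le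
  have : (1 + (Cg : ℝ)) ≤ K ^ 2 := hK.trans (by nlinarith)
  exact mul_le_mul_of_nonneg_right this (by positivity)

/-- **The `(u, p)` bound transfers**: from `∫∫_{Q₁} (|u|³ + |p|^{3/2}) ≤ λ³`, the pressure bound
`‖π‖_{L^{3/2}} ≤ C ‖1_{Q₁} f‖_{L^{3/2}}` and `∫∫_{Q₁} |f|^q ≤ λ^{2q}` to
`∫∫_{Q₁} (|u|³ + |p - π|^{3/2}) ≤ (Kλ)³` for every `K ≥ 1 + M^{3/2}`, `M = 1 + C |Q₁|^{2/3 - 1/q}`.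
[folklore] -/
theorem lintegral_up_sub_le (hq : 3 / 2 ≤ q) (hl : 0 ≤ l)
    (hu : AEStronglyMeasurable (uncurry u) (volume.restrict (parabolicCylinder 1 z₀)))
    (hp : MemLp (uncurry p) p₃₂ (volume.restrict (parabolicCylinder 1 z₀)))
    (hf : MemLp (uncurry f) (ENNReal.ofReal q) (volume.restrict (parabolicCylinder 1 z₀)))
    (hπ : MemLp π p₃₂ volume)
    (hP : eLpNorm π p₃₂ volume ≤ Cπ * eLpNorm ((parabolicCylinder 1 z₀).indicator (uncurry f)) p₃₂ volume)
    (hUP : ∫⁻ w in parabolicCylinder 1 z₀,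
      (‖u w.1 w.2‖ₑ ^ (3 : ℕ) + ‖p w.1 w.2‖ₑ ^ (3 / 2 : ℝ)) ≤ ENNReal.ofReal (l ^ 3))
    (hF : ∫⁻ w in parabolicCylinder 1 z₀, ‖f w.1 w.2‖ₑ ^ q ≤ ENNReal.ofReal (l ^ (2 * q)))
    {K : ℝ} (hK : 1 + ((1 + (Cπ : ℝ≥0∞) * volume (ball (0 : ℝ³) 1) ^
      (1 / (p₃₂).toReal - 1 / (ENNReal.ofReal q).toReal)).toReal) ^ (3 / 2 : ℝ) ≤ K) :
    ∫⁻ w in parabolicCylinder 1 z₀,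
      (‖u w.1 w.2‖ₑ ^ (3 : ℕ) + ‖p w.1 w.2 - π (w.1, w.2)‖ₑ ^ (3 / 2 : ℝ)) ≤
      ENNReal.ofReal ((K * l) ^ 3) := by
  have hq0 : 0 < q := by linarith
  set μ := volume.restrict (parabolicCylinder 1 z₀)
  set V : ℝ≥0∞ := volume (ball (0 : ℝ³) 1) ^ (1 / (p₃₂).toReal - 1 / (ENNReal.ofReal q).toReal)
    with hV
  have hVtop : V ≠ ⊤ := volumeFactor_ne_top hq
  set M : ℝ≥0∞ := 1 + (Cπ : ℝ≥0∞) * V with hM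
  have hMtop : M ≠ ⊤ := ENNReal.add_ne_top.2 ⟨ENNReal.one_ne_top, ENNReal.mul_ne_top ENNReal.coe_ne_top hVtop⟩
  have hK1 : 1 ≤ K := le_trans (by simp; positivity) hK
  -- split the hypothesis
  have hmeas_u : AEMeasurable (fun w : ℝ × ℝ³ => ‖u w.1 w.2‖ₑ ^ (3 : ℕ)) μ := (hu.enorm.pow_const _)
  have hu3 : ∫⁻ w in parabolicCylinder 1 z₀, ‖u w.1 w.2‖ₑ ^ (3 : ℕ) ≤ ENNReal.ofReal (l ^ 3) :=
    (lintegral_mono fun w => le_self_add).trans hUP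
  have hp3 : ∫⁻ w in parabolicCylinder 1 z₀, ‖p w.1 w.2‖ₑ ^ (3 / 2 : ℝ) ≤ ENNReal.ofReal (l ^ 3) :=
    (lintegral_mono fun w => le_add_self).trans hUP
  -- `‖p‖_{L^{3/2}(Q₁)} ≤ λ²`
  have hp2 : eLpNorm (uncurry p) p₃₂ μ ≤ ENNReal.ofReal (l ^ 2) := by
    rw [p32_eq_ofReal]
    refine eLpNorm_le_of_lintegral_le (by norm_num) (by positivity) ?_
    rw [sq_rpow_three_halves hl]; exact hp3
  -- `‖f‖_{L^{3/2}(Q₁)} ≤ |Q₁|^{2/3-1/q} λ²`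
  have hf2 : eLpNorm (uncurry f) (ENNReal.ofReal q) μ ≤ ENNReal.ofReal (l ^ 2) := by
    refine eLpNorm_le_of_lintegral_le hq0 (by positivity) ?_
    have e : (l ^ 2) ^ q = l ^ (2 * q) := by
      rw [← Real.rpow_natCast l 2, ← Real.rpow_mul hl]; norm_num
    rw [e]; exact hF
  have hf32 : eLpNorm (uncurry f) p₃₂ μ ≤ ENNReal.ofReal (l ^ 2) * V := by
    have h := eLpNorm_le_eLpNorm_mul_rpow_measure_univ (p32_le_ofReal hq) hf.1 (μ := μ)
    rw [Measure.restrict_apply_univ, volume_parabolicCylinder_one] at h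
    exact h.trans (mul_le_mul_left hf2 _)
  -- `‖p - π‖_{L^{3/2}(Q₁)} ≤ M λ²`
  have hpπ : eLpNorm (uncurry fun t x => p t x - π (t, x)) p₃₂ μ ≤ ENNReal.ofReal (l ^ 2) * M := by
    have e : (uncurry fun t x => p t x - π (t, x)) = uncurry p - π := by funext z; rfl
    rw [e]
    calc eLpNorm (uncurry p - π) p₃₂ μ ≤ eLpNorm (uncurry p) p₃₂ μ + eLpNorm π p₃₂ μ :=
          eLpNorm_sub_le hp.1 (hπ.restrict _).1 one_le_p32
      _ ≤ ENNReal.ofReal (l ^ 2) + Cπ * (ENNReal.ofReal (l ^ 2) * V) := by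
          refine add_le_add hp2 ?_
          refine (eLpNorm_mono_measure π Measure.restrict_le_self).trans (hP.trans ?_)
          rw [eLpNorm_indicator_cyl]
          exact mul_le_mul_right hf32 _
      _ = ENNReal.ofReal (l ^ 2) * M := by rw [hM]; ring
  have hpπ3 : ∫⁻ w in parabolicCylinder 1 z₀, ‖p w.1 w.2 - π (w.1, w.2)‖ₑ ^ (3 / 2 : ℝ) ≤
      ENNReal.ofReal (l ^ 3) * M ^ (3 / 2 : ℝ) := by
    rw [p32_eq_ofReal] at hpπ
    have h := lintegral_le_of_eLpNorm_le (by norm_num : (0 : ℝ) < 3 / 2) hpπ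
    refine h.trans_eq ?_
    rw [ENNReal.mul_rpow_of_nonneg _ _ (by norm_num),
      ENNReal.ofReal_rpow_of_nonneg (by positivity) (by norm_num), sq_rpow_three_halves hl]
  -- add up
  have hmeas_p : AEMeasurable (fun w : ℝ × ℝ³ => ‖p w.1 w.2 - π (w.1, w.2)‖ₑ ^ (3 / 2 : ℝ)) μ :=
    ((hp.1.sub (hπ.restrict _).1).enorm.pow_const _)
  calc ∫⁻ w in parabolicCylinder 1 z₀,
        (‖u w.1 w.2‖ₑ ^ (3 : ℕ) + ‖p w.1 w.2 - π (w.1, w.2)‖ₑ ^ (3 / 2 : ℝ))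
      = (∫⁻ w in parabolicCylinder 1 z₀, ‖u w.1 w.2‖ₑ ^ (3 : ℕ)) +
          ∫⁻ w in parabolicCylinder 1 z₀, ‖p w.1 w.2 - π (w.1, w.2)‖ₑ ^ (3 / 2 : ℝ) :=
        lintegral_add_left' hmeas_u _
    _ ≤ ENNReal.ofReal (l ^ 3) + ENNReal.ofReal (l ^ 3) * M ^ (3 / 2 : ℝ) := add_le_add hu3 hpπ3
    _ = ENNReal.ofReal (l ^ 3) * (1 + M ^ (3 / 2 : ℝ)) := by ring
    _ ≤ ENNReal.ofReal (l ^ 3) * ENNReal.ofReal (K ^ 3) := by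
        gcongr
        -- `1 + M^{3/2} = ofReal (1 + M.toReal^{3/2}) ≤ ofReal K ≤ ofReal K³`
        have e : 1 + M ^ (3 / 2 : ℝ) = ENNReal.ofReal (1 + M.toReal ^ (3 / 2 : ℝ)) := by
          rw [ENNReal.ofReal_add zero_le_one (by positivity), ENNReal.ofReal_one,
            ← ENNReal.ofReal_rpow_of_nonneg ENNReal.toReal_nonneg (by norm_num),
            ENNReal.ofReal_toReal hMtop]
        rw [e]
        refine ENNReal.ofReal_le_ofReal (hK.trans ?_)
        calc K = K ^ 1 := (pow_one K).symm
          _ ≤ K ^ 3 := pow_le_pow_right₀ hK1 (by norm_num)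
    _ = ENNReal.ofReal ((K * l) ^ 3) := by
        rw [← ENNReal.ofReal_mul (by positivity)]; congr 1; ring

end Bounds

/-! ### The theorems -/

/-- **Thm. 14.4 at `ν = 1`, `r₀ = 1` for a general force follows from the same statement for
solenoidal forces** (the shape of the conclusion of the accepted
`lemarieRieusset_unitScale_nu_one_divFree_of_theorem15_3_force`): localise to `Q_1(z₀)`, absorb
the gradient part of `1_{Q_1(z₀)} f` into the pressure (`isLRSuitableWeakSolutionOn_absorb`,
`divFree_absorb`), and apply the solenoidal statement with `λ' = K λ`, `K = K(q)`.
[cite: LemarieRieusset2016, Thm. 14.4 p. 505; CaffarelliKohnNirenberg1982 §1] -/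
theorem lemarieRieusset_epsilon_regularity_nu_one_of_divFree
    (h : ∀ ⦃q : ℝ⦄, 5 / 2 < q → ∃ ε₀ C₀ : ℝ, 0 < ε₀ ∧ 0 < C₀ ∧
      ∀ (Ω : Opens (ℝ × ℝ³)) (f u : ℝ → ℝ³ → ℝ³) (p : ℝ → ℝ³ → ℝ) (G : ℝ → ℝ³ → ℝ³ →L[ℝ] ℝ³),
        IsLRSuitableWeakSolutionOn Ω 1 q f u p G →
        (∀ φ : ℝ → ℝ³ → ℝ, IsSpaceTimeTestOn Ω φ → ∫ t, ∫ x, ⟪f t x, gradient (φ t) x⟫ = 0) →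
        ∀ (z₀ : ℝ × ℝ³) (l : ℝ), parabolicCylinder 1 z₀ ⊆ (Ω : Set (ℝ × ℝ³)) → 0 ≤ l → l ≤ ε₀ →
          ∫⁻ w in parabolicCylinder 1 z₀,
              (‖u w.1 w.2‖ₑ ^ (3 : ℕ) + ‖p w.1 w.2‖ₑ ^ (3 / 2 : ℝ)) ≤ ENNReal.ofReal (l ^ 3) →
          ∫⁻ w in parabolicCylinder 1 z₀, ‖f w.1 w.2‖ₑ ^ q ≤ ENNReal.ofReal (l ^ (2 * q)) →
          ∀ᵐ w ∂(volume.restrict (parabolicCylinder (1 / 2) z₀)), ‖u w.1 w.2‖ ≤ C₀ * l) :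
    lemarieRieusset_epsilon_regularity_nu_one := by
  intro q hq
  obtain ⟨ε₁, C₁, hε₁, hC₁, H⟩ := h hq
  have hq32 : 3 / 2 ≤ q := by linarith
  obtain ⟨Cg, Cπ, hH⟩ := exists_localHelmholtz (p := ENNReal.ofReal q) (p32_le_ofReal hq32)
    ENNReal.ofReal_lt_top
  -- the constant `K = K(q)`
  set V : ℝ≥0∞ := volume (ball (0 : ℝ³) 1) ^ (1 / (p₃₂).toReal - 1 / (ENNReal.ofReal q).toReal)
  set K : ℝ := max (1 + (Cg : ℝ)) (1 + ((1 + (Cπ : ℝ≥0∞) * V).toReal) ^ (3 / 2 : ℝ)) with hK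
  have hK1 : 1 ≤ K := le_trans (by simp) (le_max_left _ _)
  have hK0 : 0 < K := one_pos.trans_le hK1
  refine ⟨ε₁ / K, C₁ * K, div_pos hε₁ hK0, by positivity, ?_⟩
  intro Ω f u p G hS z₀ l hsub hl hlε hUP hF
  -- `u ∈ L³(Q₁)`
  have hu3 : ∫⁻ w in parabolicCylinder 1 z₀, ‖u w.1 w.2‖ₑ ^ (3 : ℕ) < ⊤ :=
    ((lintegral_mono fun w => le_self_add).trans hUP).trans_lt ENNReal.ofReal_lt_top
  -- the Helmholtz pair of `1_{Q₁} f`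
  obtain ⟨π, 𝒢, hπ, h𝒢, hG, hP, hgrad, hdiv, πs, hπs, htπ, ht𝒢⟩ :=
    hH z₀ ((parabolicCylinder 1 z₀).indicator (uncurry f)) (memLp_indicator_cyl (memLp_f hS hsub))
      support_indicator_subset
  have hS' := isLRSuitableWeakSolutionOn_absorb hS hq32 hsub hu3 hπ h𝒢 hgrad hπs htπ ht𝒢
  have hdiv' : ∀ φ : ℝ → ℝ³ → ℝ, IsSpaceTimeTestOn (parabolicCylinderOpens 1 z₀) φ →
      ∫ t, ∫ x, ⟪(fun t x => f t x - 𝒢 (t, x)) t x, gradient (φ t) x⟫ = 0 :=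
    fun φ hφ => divFree_absorb hS hq32 hsub h𝒢 hdiv hφ
  -- the transferred smallness
  have hl' : 0 ≤ K * l := by positivity
  have hl'ε : K * l ≤ ε₁ := by rwa [le_div_iff₀ hK0, mul_comm] at hlε
  have hF' := lintegral_force_sub_le hq32 hl (memLp_f hS hsub) h𝒢 hG hF (le_max_left _ _ : _ ≤ K)
  have hUP' := lintegral_up_sub_le hq32 hl (aesm_u hS hsub) (memLp_p_p32 hS hsub) (memLp_f hS hsub)
    hπ hP hUP hF (le_max_right _ _ : _ ≤ K)
  have key := H _ _ u _ G hS' hdiv' z₀ (K * l) subset_rfl hl' hl'ε hUP' hF'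
  filter_upwards [key] with w hw
  rwa [mul_assoc]

/-- **Thm. 14.4 at `ν = 1`, `r₀ = 1` for a general force from the named solenoidal statement**
`lemarieRieusset_epsilon_regularity_nu_one_divFree` of `CKNEpsilonRegularityDivFree` (same
shape as the hypothesis of `lemarieRieusset_epsilon_regularity_nu_one_of_divFree`).
[cite: LemarieRieusset2016, Thm. 14.4 p. 505; CaffarelliKohnNirenberg1982 §1] -/
theorem lemarieRieusset_epsilon_regularity_nu_one_of_nu_one_divFree
    (h : lemarieRieusset_epsilon_regularity_nu_one_divFree) :
    lemarieRieusset_epsilon_regularity_nu_one :=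
  lemarieRieusset_epsilon_regularity_nu_one_of_divFree fun q hq => h q hq

/-- **Thm. 14.4 at `ν = 1`, `r₀ = 1` from the first local regularity theorem with force.**
[cite: LemarieRieusset2016, Thm. 14.4 p. 505; RobinsonRodrigoSadowski2016 Thm. 15.3] -/
theorem lemarieRieusset_epsilon_regularity_nu_one_of_theorem15_3_force
    (h : RRS2016.theorem15_3_force) : lemarieRieusset_epsilon_regularity_nu_one :=
  lemarieRieusset_epsilon_regularity_nu_one_of_divFree fun _ hq =>
    lemarieRieusset_unitScale_nu_one_divFree_of_theorem15_3_force h hq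

/-- **Thm. 14.4 (all viscosities and scales) from the first local regularity theorem with
force**, by the accepted normalisation of the viscosity
(`lemarieRieusset_epsilon_regularity_of_nu_one`). [cite: LemarieRieusset2016, Thm. 14.4 p. 505] -/
theorem lemarieRieusset_epsilon_regularity_of_theorem15_3_force
    (h : RRS2016.theorem15_3_force) : lemarieRieusset_epsilon_regularity :=
  lemarieRieusset_epsilon_regularity_of_nu_one
    (lemarieRieusset_epsilon_regularity_nu_one_of_theorem15_3_force h)

/-- **Thm. 14.4 from the two remaining named facts of the Robinson–Rodrigo–Sadowski route**:
Step 2 with force (`RRS2016.step2_force`) and the local pressure estimate (`RRS2016.lemma15_12`).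
[cite: LemarieRieusset2016, Thm. 14.4 p. 505; RobinsonRodrigoSadowski2016 Thm. 15.3, Lemma 15.12] -/
theorem lemarieRieusset_epsilon_regularity_nu_one_of_step2_of_lemma15_12
    (h2 : RRS2016.step2_force) (h12 : RRS2016.lemma15_12) :
    lemarieRieusset_epsilon_regularity_nu_one :=
  lemarieRieusset_epsilon_regularity_nu_one_of_theorem15_3_force
    (RRS2016.theorem15_3_force_of_step2 h2 h12)

/-- **Thm. 14.4 at `ν = 1`, `r₀ = 1` from the local pressure estimate alone**: Step 2 with force
is the accepted `RRS2016.step2_force_of_lemma15_11` applied to `RRS2016.lemma15_11_holds`, so the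
only remaining named fact is Robinson–Rodrigo–Sadowski's Lemma 15.12.
[cite: LemarieRieusset2016, Thm. 14.4 p. 505; RobinsonRodrigoSadowski2016 Lemma 15.12 p. 232] -/
theorem lemarieRieusset_epsilon_regularity_nu_one_of_lemma15_12 (h12 : RRS2016.lemma15_12) :
    lemarieRieusset_epsilon_regularity_nu_one :=
  lemarieRieusset_epsilon_regularity_nu_one_of_step2_of_lemma15_12
    (RRS2016.step2_force_of_lemma15_11 RRS2016.lemma15_11_holds) h12

/-- **Thm. 14.4 (all `ν`, `r₀`) from Lemma 15.12 alone.** [cite: LemarieRieusset2016, Thm. 14.4 p. 505] -/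
theorem lemarieRieusset_epsilon_regularity_of_lemma15_12 (h12 : RRS2016.lemma15_12) :
    lemarieRieusset_epsilon_regularity :=
  lemarieRieusset_epsilon_regularity_of_nu_one
    (lemarieRieusset_epsilon_regularity_nu_one_of_lemma15_12 h12)

end Literature.Analysis.FluidPDE

end
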